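import Literature.NumberTheory.Sieve.FGKMT2018LocalPairSumTotal
import Literature.NumberTheory.Sieve.Maynard2016Lemma82
import Literature.NumberTheory.Sieve.Maynard2016DenseClustersRFoldSums
import HarnessLib

/-!
# FGKMT 2018 Theorem 6 / Maynard 2016 Prop. 9.1: `∑_{r ∈ 𝒟_k} y_r²/φ_ω(r)` is an `r`-fold sum of Lemma 8.4

Sources: J. Maynard, *Dense clusters of primes in subsets*, Compositio Math. 152 (2016) =
arXiv:1405.2593 [Maynard2016DenseClusters], §7 p. 13 (the support set `𝒟_k(𝓛)`: «we restrict …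
to have no prime factor `p` dividing any `d_j` for `j` not one of the chosen indices …, i.e.
`(d_j, W_j) = 1`») and proof of Proposition 9.1 p. 20, display (9.4): «We estimate the inner sum
`∑_{r ∈ 𝒟_k} y_r²/φ_ω(r)` by applying Lemma 8.4 (with `Ω_G = T_k²`)»; K. Ford, B. Green,
S. Konyagin, J. Maynard, T. Tao, *Long gaps between primes*, JAMS 31 (2018) = arXiv:1412.5029v4
[FordGreenKonyaginMaynardTao2018], (7.5) p. 21.

PROVED here (no named facts): the exact re-indexing that feeds `∑_r y_r²/φ_ω(r)` (the main term
left by `FGKMT2018MainTermRegroup.abs_sum_sieveWt_sub_mainSum_le`) into the `r`-fold sum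
`MaynardDense.rFoldSum` of the tree's Lemma 8.4 (`Maynard2016DenseClustersRFoldSums.lemma84_all`):

* `idxMod L B R j` — Maynard's moduli `W_j = WB · ∏ {p ≤ ⌊R⌋ prime, p ∤ WB, j not admissible at p}`;
  `mem_dkBox_iff_coprime_idxMod`: inside the box `1 ≤ eᵢ ≤ ⌊R⌋`,
  `e ∈ 𝒟_k(𝓛) ⟺ μ²(∏eᵢ) = 1 ∧ (e_j, W_j) = 1 ∀ j`;
  `rWeight_idxMod_eq`: the Lemma-8.4 weight for `A(p) = p − ω(p)` is `1_{𝒟_k}(e)/φ_ω(∏eᵢ)`;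
* **`sum_yVar_sq_div_phiOmega_eq_rFoldSum`** (`k ≥ 2`, `R > 1`, `F = F_k` of (7.4)):
  `∑_{r ∈ 𝒟_k(𝓛)} y_r²/φ_ω(r) = P² · rFoldSum k W⃗ (p ↦ p − ω(p)) (ψ²) (g_k²) R 0`,
  `P = (WB)^k/φ(WB)^k · 𝔖_{WB}(𝓛)` — the left side of (9.4) as an instance of (8.9);
* side facts for the hypotheses of Lemma 8.4: `idxMod_ne_zero`, `dvd_idxMod_of_le` (every prime
  `p ≤ 2k²` divides each `W_j`), and `nW_idxMod_eq_omegaL`: for a prime `2k² < p ≤ ⌊R⌋`, `p ∤ B`,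
  the number of `j` with `p ∤ W_j` is `ω_𝓛(p)` (so the Euler factors of `Π` are the printed
  `(1 + ω(p)/(p − ω(p)))(1 − 1/p)^k` of (9.4) for `p ≤ R`).

Caveat recorded for the (9.4) step (not used here): `lemma84_all` couples `|1 + A(p) − p| + r ≤ K`
with `p ≤ 2K² ⇒ p ∣ W_i`; with `A(p) = p − ω(p)`, `r = k` this forces `K ≥ 2k − 1`, i.e. primes up
to `2(2k−1)²` dividing `W_j`, while `W = ∏_{p ≤ 2k²}` — a decoupled-threshold variant of Lemma 8.3/8.4
is what (9.4) needs.

## References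
* J. Maynard, *Dense clusters of primes in subsets*, Compositio Math. 152 (2016), §7, Lemma 8.4,
  Prop. 9.1 (9.4) [Maynard2016DenseClusters].
* K. Ford, B. Green, S. Konyagin, J. Maynard, T. Tao, *Long gaps between primes*, JAMS 31 (2018),
  (7.5) [FordGreenKonyaginMaynardTao2018].
-/

noncomputable section

open Finset
open scoped ArithmeticFunction.Moebius

namespace Literature.NumberTheory.Sieve.FGKMT2018

variable {k : ℕ}

/-! ### Maynard's moduli `W_j` -/

open scoped Classical in
/-- `W_j = WB · ∏ {p prime, p ≤ ⌊R⌋, p ∤ WB, j ∉ admIdx(p)}`: `(e_j, W_j) = 1` says that `e_j` is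
coprime to `WB` and divisible only by primes at which `j` is an admissible index.
[cite: Maynard2016DenseClusters, §7 p. 13 («(d_j, W_j) = 1»)] -/
def idxMod (L : Fin k → ℤ × ℤ) (B : ℕ) (R : ℝ) (j : Fin k) : ℕ :=
  wCut k B * B * ∏ p ∈ (Finset.range (⌊R⌋₊ + 1)).filter
    (fun p => p.Prime ∧ ¬ p ∣ wCut k B * B ∧ j ∉ admIdx L p), p

/-- `wCut k B ≠ 0`. [cite: FordGreenKonyaginMaynardTao2018, §7 p. 21 (W = ∏_{p ≤ 2k², p ∤ B} p)] -/
theorem wCut_ne_zero (k B : ℕ) : wCut k B ≠ 0 := by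
  classical
  unfold wCut
  exact Finset.prod_ne_zero_iff.2 fun p hp => (Finset.mem_filter.1 hp).2.1.ne_zero

/-- `W_j ≠ 0` (for `B ≠ 0`). [cite: Maynard2016DenseClusters, §7 p. 13] -/
theorem idxMod_ne_zero (L : Fin k → ℤ × ℤ) {B : ℕ} (hB : B ≠ 0) (R : ℝ) (j : Fin k) :
    idxMod L B R j ≠ 0 := by
  classical
  unfold idxMod
  refine Nat.mul_ne_zero (Nat.mul_ne_zero (wCut_ne_zero k B) hB) ?_
  exact Finset.prod_ne_zero_iff.2 fun p hp => (Finset.mem_filter.1 hp).2.1.ne_zero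

/-- Every prime `p ≤ 2k²` divides `WB`, hence each `W_j` (hypothesis «`W_i` a multiple of
`∏_{p ≤ 2k²} p`» of Lemmas 8.3/8.4). [cite: Maynard2016DenseClusters, Lemma 8.4 (hypotheses), §7 p. 13] -/
theorem dvd_wCut_mul_of_le {k B p : ℕ} (hp : p.Prime) (hple : p ≤ 2 * k ^ 2) : p ∣ wCut k B * B := by
  classical
  by_cases hpB : p ∣ B
  · exact hpB.mul_left _
  · refine Dvd.dvd.mul_right ?_ B
    unfold wCut
    exact Finset.dvd_prod_of_mem _ (Finset.mem_filter.2 ⟨Finset.mem_range.2 (by omega), hp, hpB⟩)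

/-- Every prime `p ≤ 2k²` divides `W_j`. [cite: Maynard2016DenseClusters, Lemma 8.4 (hypotheses)] -/
theorem dvd_idxMod_of_le (L : Fin k → ℤ × ℤ) (B : ℕ) (R : ℝ) (j : Fin k) {p : ℕ} (hp : p.Prime)
    (hple : p ≤ 2 * k ^ 2) : p ∣ idxMod L B R j := by
  unfold idxMod
  exact (dvd_wCut_mul_of_le hp hple).mul_right _

/-- For a prime `p ≤ ⌊R⌋` with `p ∤ WB`: `p ∣ W_j ⟺ j ∉ admIdx(p)`.
[cite: Maynard2016DenseClusters, §7 p. 13] -/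
theorem prime_dvd_idxMod_iff {L : Fin k → ℤ × ℤ} {B : ℕ} {R : ℝ} {j : Fin k} {p : ℕ} (hp : p.Prime)
    (hpW : ¬ p ∣ wCut k B * B) (hpR : p ≤ ⌊R⌋₊) : p ∣ idxMod L B R j ↔ j ∉ admIdx L p := by
  classical
  unfold idxMod
  rw [hp.dvd_mul, (Nat.prime_iff.1 hp).dvd_finsetProd_iff]
  constructor
  · rintro (h | ⟨q, hq, hpq⟩)
    · exact absurd h hpW
    · obtain ⟨-, hqp, -, hj⟩ := Finset.mem_filter.1 hq
      have : p = q := (Nat.prime_dvd_prime_iff_eq hp hqp).1 hpq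
      subst this
      exact hj
  · intro hj
    exact Or.inr ⟨p, Finset.mem_filter.2 ⟨Finset.mem_range.2 (by omega), hp, hpW, hj⟩, dvd_rfl⟩

/-- **`𝒟_k(𝓛)` via the moduli `W_j`**: for `e` in the box `1 ≤ eᵢ ≤ ⌊R⌋`,
`e ∈ 𝒟_k(𝓛) ⟺ μ²(∏eᵢ) = 1 ∧ (e_j, W_j) = 1 ∀ j`.
[cite: Maynard2016DenseClusters, §7 p. 13; FordGreenKonyaginMaynardTao2018, (7.5) p. 21] -/
theorem mem_dkBox_iff_coprime_idxMod {L : Fin k → ℤ × ℤ} {B : ℕ} {R : ℝ} {e : Fin k → ℕ}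
    (he : e ∈ Fintype.piFinset fun _ : Fin k => Finset.Icc 1 ⌊R⌋₊) :
    e ∈ dkBox L B R ↔ Squarefree (∏ i, e i) ∧ ∀ j, (e j).Coprime (idxMod L B R j) := by
  classical
  have he' : ∀ i, e i ∈ Finset.Icc 1 ⌊R⌋₊ := Fintype.mem_piFinset.1 he
  have he0 : ∀ i, e i ≠ 0 := fun i => Nat.one_le_iff_ne_zero.1 (Finset.mem_Icc.1 (he' i)).1
  rw [mem_dkBox_iff]
  constructor
  · rintro ⟨-, hsq, hcop, hidx⟩
    refine ⟨hsq, fun j => ?_⟩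
    have hjW : (e j).Coprime (wCut k B * B) :=
      Nat.Coprime.coprime_dvd_left (Finset.dvd_prod_of_mem e (Finset.mem_univ j)) hcop
    unfold idxMod
    refine Nat.Coprime.mul_right hjW (Nat.Coprime.prod_right fun p hp => ?_)
    obtain ⟨-, hpp, -, hj⟩ := Finset.mem_filter.1 hp
    rw [Nat.coprime_comm, hpp.coprime_iff_not_dvd]
    intro hpe
    exact hj (mem_admIdx.2 (hidx j p (Nat.mem_primeFactors.2 ⟨hpp, hpe, he0 j⟩)))
  · rintro ⟨hsq, hcop⟩
    refine ⟨he', hsq, Nat.Coprime.prod_left fun i _ =>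
      Nat.Coprime.coprime_dvd_right (Dvd.intro _ rfl) (hcop i), fun j p hp => ?_⟩
    have hpp := Nat.prime_of_mem_primeFactors hp
    have hpe := Nat.dvd_of_mem_primeFactors hp
    have hpR : p ≤ ⌊R⌋₊ := (Nat.le_of_dvd (Nat.pos_of_ne_zero (he0 j)) hpe).trans
      (Finset.mem_Icc.1 (he' j)).2
    have hpW : ¬ p ∣ wCut k B * B := fun h =>
      Nat.not_coprime_of_dvd_of_dvd hpp.one_lt hpe h
        (Nat.Coprime.coprime_dvd_right (Dvd.intro _ rfl) (hcop j))
    by_contra hnot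
    have hj : j ∉ admIdx L p := fun h => hnot (mem_admIdx.1 h)
    exact Nat.not_coprime_of_dvd_of_dvd hpp.one_lt hpe
      ((prime_dvd_idxMod_iff hpp hpW hpR).2 hj) (hcop j)

/-- **The Lemma-8.4 weight is `1_{𝒟_k}/φ_ω`**: for `e` in the box and `A(p) = p − ω_𝓛(p)`,
`rWeight k W⃗ A e = 1_{𝒟_k(𝓛)}(e)/φ_ω(∏eᵢ)`.
[cite: Maynard2016DenseClusters, proof of Prop. 9.1 (9.4) (the sum is of the form (8.9) with g = φ_ω)] -/
theorem rWeight_idxMod_eq {L : Fin k → ℤ × ℤ} {B : ℕ} {R : ℝ} {e : Fin k → ℕ}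
    (he : e ∈ Fintype.piFinset fun _ : Fin k => Finset.Icc 1 ⌊R⌋₊) :
    MaynardDense.rWeight k (idxMod L B R) (fun p => (p : ℝ) - omegaL L p) e =
      if e ∈ dkBox L B R then (phiOmega L (∏ i, e i))⁻¹ else 0 := by
  classical
  unfold MaynardDense.rWeight phiOmega
  by_cases h : e ∈ dkBox L B R
  · rw [if_pos ((mem_dkBox_iff_coprime_idxMod he).1 h), if_pos h]
  · rw [if_neg (fun h' => h ((mem_dkBox_iff_coprime_idxMod he).2 h')), if_neg h]

/-- `𝒟_k(𝓛)` sits inside the box. [cite: FordGreenKonyaginMaynardTao2018, (7.5) p. 21] -/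
theorem dkBox_subset_piFinset (L : Fin k → ℤ × ℤ) (B : ℕ) (R : ℝ) :
    dkBox L B R ⊆ Fintype.piFinset fun _ : Fin k => Finset.Icc 1 ⌊R⌋₊ := by
  classical
  unfold dkBox
  exact Finset.filter_subset _ _

/-- **`∑_{r ∈ 𝒟_k(𝓛)} y_r²/φ_ω(r) = P² · rFoldSum k W⃗ (p ↦ p − ω(p)) (ψ²) (g_k²) R 0`**,
`P = (WB)^k/φ(WB)^k 𝔖_{WB}(𝓛)`, for the test function `F = F_k` of (7.4) (`k ≥ 2`, `R > 1`):
the left side of (9.4) is an `r`-fold sum (8.9) of Lemma 8.4 with `Φ = ψ²`, `G = g_k²`, `g = φ_ω`.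
[cite: Maynard2016DenseClusters, proof of Prop. 9.1 p. 20, (9.4) («by applying Lemma 8.4»)] -/
theorem sum_yVar_sq_div_phiOmega_eq_rFoldSum {k : ℕ} (hk : 2 ≤ k) (L : Fin k → ℤ × ℤ) (B : ℕ)
    {R : ℝ} (hR : 1 < R) :
    ∑ r ∈ dkBox L B R, yVar L B R (MaynardDense.F k) r ^ 2 / phiOmega L (∏ i, r i) =
      (((wCut k B * B : ℕ) : ℝ) ^ k / (Nat.totient (wCut k B * B) : ℝ) ^ k *
          singSeriesExcl L (wCut k B * B)) ^ 2 *
        MaynardDense.rFoldSum k (idxMod L B R) (fun p => (p : ℝ) - omegaL L p)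
          (fun x => MaynardDense.psi x ^ 2) (fun t => MaynardDense.profExt k t ^ 2) R 0 := by
  classical
  set P : ℝ := ((wCut k B * B : ℕ) : ℝ) ^ k / (Nat.totient (wCut k B * B) : ℝ) ^ k *
    singSeriesExcl L (wCut k B * B) with hP
  have hG1 : ∀ t : ℝ, 1 ≤ t → MaynardDense.profExt k t ^ 2 = 0 := fun t ht => by
    rw [MaynardDense.profExt_eq_zero_of_one_le hk ht]; ring
  rw [← MaynardDense.sum_piFinset_Icc_eq_rFoldSum k (idxMod L B R) _ _ hG1 hR 0, Finset.mul_sum]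
  -- restrict the box sum to `𝒟_k` using the weight
  have hrw : ∀ e ∈ Fintype.piFinset (fun _ : Fin k => Finset.Icc 1 ⌊R⌋₊),
      P ^ 2 * (MaynardDense.rWeight k (idxMod L B R) (fun p => (p : ℝ) - omegaL L p) e *
        ((fun x => MaynardDense.psi x ^ 2) (0 + ∑ i, MaynardDense.uOf R (e i)) *
          ∏ i, (fun t => MaynardDense.profExt k t ^ 2) (MaynardDense.uOf R (e i)))) =
      if e ∈ dkBox L B R then
        P ^ 2 * ((phiOmega L (∏ i, e i))⁻¹ *
          (MaynardDense.psi (∑ i, MaynardDense.uOf R (e i)) ^ 2 *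
            ∏ i, MaynardDense.profExt k (MaynardDense.uOf R (e i)) ^ 2)) else 0 := by
    intro e he
    rw [rWeight_idxMod_eq he]
    split_ifs
    · simp only [zero_add]
    · rw [zero_mul, mul_zero]
  rw [Finset.sum_congr rfl hrw, ← Finset.sum_filter, Finset.filter_mem_eq_inter,
    Finset.inter_eq_right.2 (dkBox_subset_piFinset L B R)]
  refine Finset.sum_congr rfl fun r hr => ?_
  have hr1 : ∀ i, 1 ≤ r i := one_le_of_mem_dkBox hr
  have hlogR : 0 < Real.log R := Real.log_pos hR
  have hu : ∀ i, MaynardDense.uOf R (r i) = Real.log (r i) / Real.log R := fun i => rfl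
  have hu0 : ∀ i, 0 ≤ MaynardDense.uOf R (r i) := fun i =>
    div_nonneg (Real.log_nonneg (by exact_mod_cast hr1 i)) hlogR.le
  rw [yVar_eq_mul_F L B hR.le r hr1]
  unfold MaynardDense.F
  have hprof : ∀ i, MaynardDense.prof k (Real.log (r i) / Real.log R) =
      MaynardDense.profExt k (MaynardDense.uOf R (r i)) := fun i => by
    rw [← hu i, MaynardDense.profExt_of_nonneg hk (hu0 i)]
  simp_rw [hprof, ← hu]
  rw [Finset.prod_pow]
  ring

/-! ### The number of free indices at `p`: `n(p) = ω_𝓛(p)` -/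

/-- For a prime `p ≤ ⌊R⌋` with `p ∤ WB` and admissible `𝓛`: `#{j : p ∤ W_j} = ω_𝓛(p)` (the Euler
factor of `Π` at such `p` is `(1 + ω(p)/(p − ω(p)))(1 − 1/p)^k`, as printed in (9.4)).
[cite: Maynard2016DenseClusters, proof of Prop. 9.1 (9.4) (the product ∏_{p∤WB}(1 + ω(p)/(p − ω(p)))(1 − 1/p)^k); §7 p. 13] -/
theorem nW_idxMod_eq_omegaL {L : Fin k → ℤ × ℤ} (hadm : FormsAdmissible L) {B : ℕ} {R : ℝ} {p : ℕ}
    (hp : p.Prime) (hpW : ¬ p ∣ wCut k B * B) (hpR : p ≤ ⌊R⌋₊) :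
    MaynardDense.nW k (idxMod L B R) p = omegaL L p := by
  classical
  unfold MaynardDense.nW
  rw [← card_admIdx hadm hp]
  have h : ∀ i : Fin k, (if p ∣ idxMod L B R i then 0 else 1) =
      (if i ∈ admIdx L p then 1 else 0 : ℕ) := fun i => by
    by_cases hi : i ∈ admIdx L p
    · rw [if_pos hi, if_neg (fun h => (prime_dvd_idxMod_iff hp hpW hpR).1 h hi)]
    · rw [if_neg hi, if_pos ((prime_dvd_idxMod_iff hp hpW hpR).2 hi)]
  simp_rw [h]
  rw [Finset.sum_boole, Finset.filter_mem_eq_inter, Finset.univ_inter]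
  rfl

/-- For a prime `p ∣ WB`: every `W_j` is divisible by `p`, so `n(p) = 0`.
[cite: Maynard2016DenseClusters, proof of Prop. 9.1 (9.4) (the product is over p ∤ WB)] -/
theorem nW_idxMod_eq_zero (L : Fin k → ℤ × ℤ) {B : ℕ} (R : ℝ) {p : ℕ} (hpW : p ∣ wCut k B * B) :
    MaynardDense.nW k (idxMod L B R) p = 0 := by
  classical
  unfold MaynardDense.nW
  refine Finset.sum_eq_zero fun i _ => ?_
  rw [if_pos]
  unfold idxMod
  exact hpW.mul_right _

end Literature.NumberTheory.Sieve.FGKMT2018
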